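import Mathlib
import HarnessLib
import Summits.Ventures.LatticeQCDFlow.Scoring.IMHAutocorrelationEnvelope

/-!
# A chain-side bracket for the windowed τ of the exact flow-MCMC (IMH) chain:
# `τ_{2m} ≤ τ_int ≤ τ_{2m} + (w⋆ − 1) · ρ_{2m}`

HONEST FRAMING: exact (Metropolis-corrected) sampling algorithms for lattice gauge theory;
figures of merit are autocorrelation/cost numbers at stated couplings and volumes; no
continuum-physics claim.

Venture `LatticeQCDFlow` (cell pub-lqcd), topic `Scoring`; FANOUT row 8 (`s0-cpn-nemc`, GEN-9).
NEW WORK of the cell (elementary; detailed balance + the envelope of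
`IMHAutocorrelationEnvelope.lean`), not a published result.  Context, not cited as a fact: the
'τ_exp-improved upper bound' `τ_int ≤ τ(W) + τ_exp · ρ(W)` of Schaefer–Sommer–Virotta
(arXiv:1009.5228 §2.2), used by the flow seat as reading rule R-I4 of `IMH-LAW-flow.md` with the
pool law's `τ_exp = 1/a(w_max)`; here the same shape is a THEOREM for the exact IMH chain with the
explicit constant `w⋆ − 1` in place of `τ_exp`, for even windows, with no spectral decomposition.

## Content (`p > 0`, `Σ p = 1`, `q ≥ 0`, `Σ q = 1`, `p ≤ W · q`; `c` centred; `ρ_t = S_t(c,c)/S_0(c,c)`;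
## `τ_N = tauIntWindow ρ N = 1/2 + Σ_{t=1}^{N} ρ_t`)

* `iterate_mv_centred` — a stationary kernel keeps iterates of a centred vector centred;
  `twoTime_two_mul_add` — detailed balance moves half the lag onto the vector:
  `S_{2m+s}(c, c) = S_s(Kᵐc, Kᵐc)`.
* **`imh_twoTime_even_add_le`** — TAIL DECAY FROM ANY EVEN LAG: `S_{2m+s}(c,c) ≤ (1 − 1/W)ˢ · S_{2m}(c,c)`
  (the envelope applied to the centred vector `Kᵐc`); `imh_acf_even_add_le` in `ρ` form.
* **`imh_tauIntWindow_le_tauInt`** — every windowed value is BELOW `τ_int` (`ρ ≥ 0`, the tree's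
  `imh_twoTime_nonneg`): truncation of an IMH autocorrelation sum is biased low, never high.
* **`imh_tauInt_le_window`** — `τ_int ≤ τ_{2m} + (W − 1) · ρ_{2m}` for every `m`: the measured
  window-`2m` sum plus `(w⋆ − 1)` times the measured lag-`2m` autocorrelation is a RIGOROUS upper
  bound (geometric tail `ρ_{2m+s} ≤ (1 − 1/W)ˢ ρ_{2m}`, `Σ_{s≥1} (1 − 1/W)ˢ = W − 1`).
So for an exact flow-MCMC row, `τ_int ∈ [τ_{2m}, τ_{2m} + (w⋆ − 1) ρ_{2m}]` for every even window —
a certificate computable from the chain's own autocorrelation estimates and the pool's `w⋆`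
(reading: with `w⋆` in the 10³–10⁵ range of a poorly matched flow the bracket is wide unless
`ρ_{2m}` is already tiny, which is IMH-LAW's point R-I4 in theorem form).
-/

namespace Summit.Ventures.LatticeQCDFlow.Scoring

open Finset Literature.Probability.MarkovChains Summit.Ventures.LatticeQCDFlow.Exactness

variable {X : Type*} [Fintype X] [DecidableEq X]

/-! ### Shifting the lag onto the vector -/

omit [DecidableEq X] in
/-- A `p`-stationary kernel keeps the iterates of a centred vector centred. -/
theorem iterate_mv_centred {K : Matrix X X ℝ} {p : X → ℝ} (hstat : ∀ y, ∑ x, p x * K x y = p y) :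
    ∀ (m : ℕ) (c : X → ℝ), ∑ x, p x * c x = 0 → ∑ x, p x * ((mv K)^[m] c) x = 0 := by
  intro m
  induction m with
  | zero => intro c hc; simpa using hc
  | succ m ih =>
    intro c hc
    rw [Function.iterate_succ_apply']
    exact sum_mul_mv_eq_zero_of_stationary hstat (ih c hc)

/-- Detailed balance moves half of an even lag onto the vector: `S_{2m+s}(c, c) = S_s(Kᵐc, Kᵐc)`. -/
theorem twoTime_two_mul_add {p : X → ℝ} {M : Matrix X X ℝ}
    (hDB : ∀ x y, p x * M x y = p y * M y x) (m s : ℕ) (c : X → ℝ) :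
    twoTime p M (2 * m + s) c c = twoTime p M s ((mv M)^[m] c) ((mv M)^[m] c) := by
  rw [show 2 * m + s = m + (s + m) by ring, twoTime_add_left hDB (s + m) c m c,
    twoTime_add_right p M s _ m c]

/-! ### Tail decay from an even lag -/

/-- **`S_{2m+s}(c, c) ≤ (1 − 1/W)ˢ · S_{2m}(c, c)`** for the exact flow-MCMC chain and every centred
`c`: the envelope of `IMHAutocorrelationEnvelope` applied to the centred vector `Kᵐ c`. -/
theorem imh_twoTime_even_add_le {p q : X → ℝ} {W : ℝ} (hp : ∀ x, 0 < p x) (hp1 : ∑ x, p x = 1)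
    (hq : ∀ x, 0 ≤ q x) (hq1 : ∑ x, q x = 1) (hW : ∀ x, p x ≤ W * q x) {c : X → ℝ}
    (hc : ∑ x, p x * c x = 0) (m s : ℕ) :
    twoTime p (imhMatrix p q) (2 * m + s) c c
      ≤ (1 - W⁻¹) ^ s * twoTime p (imhMatrix p q) (2 * m) c c := by
  have hDB : ∀ x y, p x * imhMatrix p q x y = p y * imhMatrix p q y x := fun x y => by
    simp only [imhMatrix_apply]
    exact imhKernel_detailedBalance hp q x y
  have hstat : ∀ y, ∑ x, p x * imhMatrix p q x y = p y := fun y => by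
    simp only [imhMatrix_apply]
    exact imhKernel_isStationary hp q y
  have hcm : ∑ x, p x * ((mv (imhMatrix p q))^[m] c) x = 0 := iterate_mv_centred hstat m c hc
  have h0 : twoTime p (imhMatrix p q) (2 * m) c c
      = twoTime p (imhMatrix p q) 0 ((mv (imhMatrix p q))^[m] c) ((mv (imhMatrix p q))^[m] c) := by
    rw [← twoTime_two_mul_add hDB m 0 c, add_zero]
  rw [twoTime_two_mul_add hDB m s c, h0]
  exact (le_abs_self _).trans (twoTime_abs_le_of_minorized (fun x => (hp x).le) hp1
    (imhKernel_isRowStochastic hp hq hq1).2 (imhKernel_isStationary hp q)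
    (fun x y => imh_minorized hp hq hq1 hW x y) hcm s)

/-- In `ρ` form: `ρ_{2m+s} ≤ (1 − 1/W)ˢ · ρ_{2m}`. -/
theorem imh_acf_even_add_le {p q : X → ℝ} {W : ℝ} (hp : ∀ x, 0 < p x) (hp1 : ∑ x, p x = 1)
    (hq : ∀ x, 0 ≤ q x) (hq1 : ∑ x, q x = 1) (hW : ∀ x, p x ≤ W * q x) {c : X → ℝ}
    (hc : ∑ x, p x * c x = 0) (m s : ℕ) :
    twoTime p (imhMatrix p q) (2 * m + s) c c / twoTime p (imhMatrix p q) 0 c c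
      ≤ (1 - W⁻¹) ^ s *
        (twoTime p (imhMatrix p q) (2 * m) c c / twoTime p (imhMatrix p q) 0 c c) := by
  have hS0 : 0 ≤ twoTime p (imhMatrix p q) 0 c c := imh_twoTime_nonneg hp hq hq1 0 c
  rw [← mul_div_assoc]
  exact div_le_div_of_nonneg_right (imh_twoTime_even_add_le hp hp1 hq hq1 hW hc m s) hS0

/-! ### The bracket -/

/-- **Every windowed value is below `τ_int`** for the exact flow-MCMC chain (`ρ_t ≥ 0` at every lag,
`Scoring.imh_twoTime_nonneg`): `tauIntWindow ρ N ≤ tauInt ρ` for every `N`. -/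
theorem imh_tauIntWindow_le_tauInt {p q : X → ℝ} {W : ℝ} (hp : ∀ x, 0 < p x) (hp1 : ∑ x, p x = 1)
    (hq : ∀ x, 0 ≤ q x) (hq1 : ∑ x, q x = 1) (hW : ∀ x, p x ≤ W * q x) {c : X → ℝ}
    (hc : ∑ x, p x * c x = 0) (N : ℕ) :
    tauIntWindow (fun t => twoTime p (imhMatrix p q) t c c / twoTime p (imhMatrix p q) 0 c c) N
      ≤ tauInt (fun t => twoTime p (imhMatrix p q) t c c / twoTime p (imhMatrix p q) 0 c c) := by
  have hρ0 : ∀ t, 0 ≤ twoTime p (imhMatrix p q) t c c / twoTime p (imhMatrix p q) 0 c c :=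
    fun t => div_nonneg (imh_twoTime_nonneg hp hq hq1 t c) (imh_twoTime_nonneg hp hq hq1 0 c)
  have hsum : Summable fun t : ℕ =>
      twoTime p (imhMatrix p q) (t + 1) c c / twoTime p (imhMatrix p q) 0 c c :=
    ((summable_nat_add_iff 1).2 (imh_twoTime_summable hp hp1 hq hq1 hW c hc)).div_const _
  unfold tauIntWindow tauInt
  have h := hsum.sum_add_tsum_nat_add N
  have htail : 0 ≤ ∑' t : ℕ,
      twoTime p (imhMatrix p q) (t + N + 1) c c / twoTime p (imhMatrix p q) 0 c c :=
    tsum_nonneg fun t => hρ0 _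
  linarith

/-- **`τ_int ≤ τ_{2m} + (W − 1) · ρ_{2m}`** for the exact flow-MCMC chain, every centred observable and
every even window `2m`: the window sum plus `(w⋆ − 1)` times the lag-`2m` autocorrelation is a
rigorous upper bound for the integrated autocorrelation time. -/
theorem imh_tauInt_le_window {p q : X → ℝ} {W : ℝ} (hp : ∀ x, 0 < p x) (hp1 : ∑ x, p x = 1)
    (hq : ∀ x, 0 ≤ q x) (hq1 : ∑ x, q x = 1) (hW : ∀ x, p x ≤ W * q x) {c : X → ℝ}
    (hc : ∑ x, p x * c x = 0) (m : ℕ) :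
    tauInt (fun t => twoTime p (imhMatrix p q) t c c / twoTime p (imhMatrix p q) 0 c c)
      ≤ tauIntWindow (fun t => twoTime p (imhMatrix p q) t c c / twoTime p (imhMatrix p q) 0 c c)
          (2 * m)
        + (W - 1) * (twoTime p (imhMatrix p q) (2 * m) c c / twoTime p (imhMatrix p q) 0 c c) := by
  obtain ⟨hr0, hr1⟩ := rate_nonneg_and_lt_one hp1 hq1 hW
  set ρ : ℕ → ℝ := fun t => twoTime p (imhMatrix p q) t c c / twoTime p (imhMatrix p q) 0 c c
    with hρ
  have hsum : Summable fun t : ℕ => ρ (t + 1) :=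
    ((summable_nat_add_iff 1).2 (imh_twoTime_summable hp hp1 hq hq1 hW c hc)).div_const _
  -- split the series at the window
  have hsplit := hsum.sum_add_tsum_nat_add (2 * m)
  -- the tail is dominated by the geometric series started at ρ (2m)
  have habs : |1 - W⁻¹| < 1 := by rw [abs_of_nonneg hr0]; exact hr1
  have hgeo := (hasSum_geometric_succ habs).mul_left (ρ (2 * m))
  have htail_sum : Summable fun t : ℕ => ρ (t + 2 * m + 1) :=
    (summable_nat_add_iff (f := fun t => ρ (t + 1)) (2 * m)).2 hsum
  have hle : ∀ t : ℕ, ρ (t + 2 * m + 1) ≤ ρ (2 * m) * (1 - W⁻¹) ^ (t + 1) := by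
    intro t
    have h := imh_acf_even_add_le hp hp1 hq hq1 hW hc m (t + 1)
    rw [show 2 * m + (t + 1) = t + 2 * m + 1 by ring] at h
    simpa [hρ, mul_comm] using h
  have htail : ∑' t : ℕ, ρ (t + 2 * m + 1) ≤ ρ (2 * m) * ((1 - W⁻¹) / (1 - (1 - W⁻¹))) := by
    rw [← hgeo.tsum_eq]
    exact Summable.tsum_le_tsum hle htail_sum hgeo.summable
  have hW1 : (1 - W⁻¹) / (1 - (1 - W⁻¹)) = W - 1 := by
    have hW0 : W ≠ 0 := by rintro rfl; simp at hr1
    field_simp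
    ring
  rw [hW1] at htail
  unfold tauInt tauIntWindow
  linarith [hsplit, htail]

/-! ### Odd windows (appended, row 8 GEN-10) -/

/-- **`τ_int ≤ τ_{2m+1} + (W − 1)(1 − 1/W) · ρ_{2m}`** — the odd-window form of `imh_tauInt_le_window`:
one more measured lag in the window, and the geometric tail certificate starts one ratio later
(`Σ_{s ≥ 2} (1 − 1/W)ˢ = (W − 1)(1 − 1/W)`; the reference lag stays the EVEN one, `2m`, where the
envelope applies to the centred vector `Kᵐ c`). -/
theorem imh_tauInt_le_window_odd {p q : X → ℝ} {W : ℝ} (hp : ∀ x, 0 < p x) (hp1 : ∑ x, p x = 1)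
    (hq : ∀ x, 0 ≤ q x) (hq1 : ∑ x, q x = 1) (hW : ∀ x, p x ≤ W * q x) {c : X → ℝ}
    (hc : ∑ x, p x * c x = 0) (m : ℕ) :
    tauInt (fun t => twoTime p (imhMatrix p q) t c c / twoTime p (imhMatrix p q) 0 c c)
      ≤ tauIntWindow (fun t => twoTime p (imhMatrix p q) t c c / twoTime p (imhMatrix p q) 0 c c)
          (2 * m + 1)
        + (W - 1) * (1 - W⁻¹)
          * (twoTime p (imhMatrix p q) (2 * m) c c / twoTime p (imhMatrix p q) 0 c c) := by
  obtain ⟨hr0, hr1⟩ := rate_nonneg_and_lt_one hp1 hq1 hW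
  have hsum : Summable fun t : ℕ =>
      twoTime p (imhMatrix p q) (t + 1) c c / twoTime p (imhMatrix p q) 0 c c :=
    ((summable_nat_add_iff 1).2 (imh_twoTime_summable hp hp1 hq hq1 hW c hc)).div_const _
  -- split the series after the odd window
  have hsplit := hsum.sum_add_tsum_nat_add (2 * m + 1)
  -- the tail is dominated by the geometric series started at λ · ρ (2m)
  have habs : |1 - W⁻¹| < 1 := by rw [abs_of_nonneg hr0]; exact hr1
  have hgeo := (hasSum_geometric_succ habs).mul_left
    (twoTime p (imhMatrix p q) (2 * m) c c / twoTime p (imhMatrix p q) 0 c c * (1 - W⁻¹))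
  have htail_sum : Summable fun t : ℕ =>
      twoTime p (imhMatrix p q) (t + (2 * m + 1) + 1) c c / twoTime p (imhMatrix p q) 0 c c :=
    (summable_nat_add_iff (f := fun t =>
      twoTime p (imhMatrix p q) (t + 1) c c / twoTime p (imhMatrix p q) 0 c c) (2 * m + 1)).2 hsum
  have hle : ∀ t : ℕ,
      twoTime p (imhMatrix p q) (t + (2 * m + 1) + 1) c c / twoTime p (imhMatrix p q) 0 c c
        ≤ twoTime p (imhMatrix p q) (2 * m) c c / twoTime p (imhMatrix p q) 0 c c * (1 - W⁻¹)
          * (1 - W⁻¹) ^ (t + 1) := by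
    intro t
    have h := imh_acf_even_add_le hp hp1 hq hq1 hW hc m (t + 2)
    rw [show 2 * m + (t + 2) = t + (2 * m + 1) + 1 by ring, pow_succ] at h
    exact h.trans_eq (by ring)
  have htail : ∑' t : ℕ,
      twoTime p (imhMatrix p q) (t + (2 * m + 1) + 1) c c / twoTime p (imhMatrix p q) 0 c c
        ≤ twoTime p (imhMatrix p q) (2 * m) c c / twoTime p (imhMatrix p q) 0 c c * (1 - W⁻¹)
          * ((1 - W⁻¹) / (1 - (1 - W⁻¹))) := by
    rw [← hgeo.tsum_eq]
    exact Summable.tsum_le_tsum hle htail_sum hgeo.summable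
  have hW1 : (1 - W⁻¹) / (1 - (1 - W⁻¹)) = W - 1 := by
    have hW0 : W ≠ 0 := by rintro rfl; simp at hr1
    field_simp
    ring
  rw [hW1] at htail
  unfold tauInt tauIntWindow
  linarith [hsplit, htail]

end Summit.Ventures.LatticeQCDFlow.Scoring
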